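import Summits.Ventures.GridStability.Bench.PLLSWINGDeg4ADuI04K32WideData
import Summits.Ventures.GridStability.Bench.PLLSWINGDeg4ADuI04K32WideBallB1
import Summits.Ventures.GridStability.Bench.PLLSWINGDeg4ADuI04K32WideBallB2
import Summits.Ventures.GridStability.Lyapunov.PolyRecastBernsteinCoeffs
import Summits.Ventures.GridStability.Lyapunov.RecastShellBounds
import Mathlib.Tactic.Linarith
import Mathlib.Tactic.Positivity
import Mathlib.Tactic.IntervalCases
import HarnessLib

/-!
# G3.d «PLL-swing» deg-4 (wide piece) — REGION-SIZE rider «PLLSWING-DEG4 BALL-B» (lever L2: BERNSTEIN enclosure on the manifold-aware SIGNED shell cover, K = 8;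
# supersession `_B`) (recast half): the ball `σ² + κ² + ω² ≤ (991/1000)²` on `{h = 0}` lies in the certified sublevel piece `{V₄ ≤ 41}`

Venture GRIDFUSION, cell `gridfusion`; seat gridfusion-lyap-2 (g6; declared INSTRUMENT line «T1-KERNEL · BERN», lead g8 RULING 9bo (1); SUPERSESSION
«BALL-B» of the rider «PLLSWING-DEG4 BALL-M» — record `Bench/PLLSWINGDeg4ADuI04K32WideBallM.lean` p562569 (s = 933/1000, coefficient majorant `absBox` on the
manifold-aware shell cover) — under NEW names: this file `Bench/PLLSWINGDeg4ADuI04K32WideBallB.lean` + box files `…BallB1…2.lean`, every declaration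
suffixed `_B`; the earlier files are untouched), LOW rider. WHAT CHANGED: the per-box test is no longer the coefficient majorant
`Σ|c_m|ΠB_i^(e_i) ≤ c` (`PolyRecast.absBox`, blind to sign cancellation between monomials) but the TENSOR-BERNSTEIN RANGE ENCLOSURE
`max_J b_J(V; box) ≤ c` (Cargo–Shisha / Garloff: on the box, `V` is a convex combination of its Bernstein coefficients), with the
coefficients COMPUTED BY THE KERNEL from the literal `deg4_A_DuI04_k32_wide_V_poly` and the box corners and RE-VERIFIED as a representation of `V`
(`Lyapunov/PolyRecastBernstein.lean` p565768: `bernUpper` ⊇ `bernRep`; `Lyapunov/PolyRecastBernsteinCoeffs.lean`: `bernCoeffs`,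
`eval_le_of_bernCoeffs`) — still ONE `decide` per box on literals only; and the boxes are the TRUE shell boxes: σ SIGNED
(`σ ∈ [τ_k, τ_(k+1)]` or `[−τ_(k+1), −τ_k]`) and `κ ∈ [κlo_k, κhi_k]` (the majorant could only use `|σ| ≤ τ_(k+1)`, `|κ| ≤ κhi_k`).
Inputs: the literal `deg4_A_DuI04_k32_wide_V_poly` (32 monomials, degree 4) and the recast constraint `deg4_A_DuI04_k32_wide_h` of `Bench/PLLSWINGDeg4ADuI04K32WideData.lean`
(sos-5 A file `cert/A/PLLSWING-deg4-A-DuI04-k32-wide.json` dbbe752aa0dbf8db; B twin sos-2 c2edc4f6a387728e; -roa `Bench/PLLSWINGDeg4ADuI04K32WideRoa.lean` lyap-1; model transport `Models/InverterPLLDuI04Roa.lean` model-3); the circle lemmas `Lyapunov/RecastShellBounds.lean` (lyap-2 g5 p560544). NOTHING of the certificate is restated; generator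
`gen_bernball.py B 8 emit` (HOME/lean/lyap-2/g6/; `s` = the largest multiple of 1/1000 whose 16 boxes pass, found in float and
CONFIRMED in exact rational arithmetic by a Python mirror of `bernCoeffs`; at `s + 1/1000` the worst box fails).

WHAT IS PROVED (kernel). With `s = 991/1000`: on `{h = 0}` (`h = κ² + σ² − 2κ`) the ellipsoid `σ² + κ² + ω² ≤ s²` is COVERED by 8 shells
`τ_k² < σ² ≤ τ_(k+1)²` up to `σ_max² = s² − s⁴/4 = 2963840909439/4000000000000` (`τ_8 = 861/1000`, `τ_8² ≥ σ_max²`; lever L1 (a)), each the union of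
TWO boxes (sign of σ) with `κlo_k ≤ κ ≤ κhi_k` (`κhi_k ≥ 1 − √(1 − τ_(k+1)²)`, `κlo_k ≤ 1 − √(1 − τ_k²)`, rational, from `(1 − κ)² = 1 − σ²`;
L1 (b)) and `|ω| ≤ Ω_k`, `Ω_k² ≥ W²(s² − 2κlo_k)`, `W = 1` (L1 (c)); on EACH of the 16 boxes the kernel-computed Bernstein coefficients
of `V` are `≤ 41` (box files, one `decide` per box; worst exact maximum ≈ 40.942371); hence `V ≤ 41 = c` on the
ellipsoid — IT LIES IN THE CERTIFIED PIECE (`deg4_A_DuI04_k32_wide_V_le_level_of_ball_B`). Reach for this row (gauge radius `s`): BALL-M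
933/1000 (53.5°) → BALL-B 991/1000 (56.8°); record ONE-box and BALL+ values in LEVER-NOTE §1 (angle = the model
reading `s·180/π` at `ω = 0`, VALIDATED
rendering of the exact literal; the float TRUE inscribed radius of the gauge ellipsoid in the piece is larger still, LEVER-NOTE §1).

THREE COLUMNS. CERTIFIED (kernel): the inclusion «ellipsoid of gauge radius `991/1000` ∩ {h = 0} ⊆ {V ≤ 41}» for the certificate's `V` —
a box-cover Bernstein-enclosure inner estimate, exact; an inner set of a CERTIFICATE's sublevel piece, never «the ROA of the system».
MODELLED: as the parent row (M′ = the PLL generalized swing equation `θ̇ = ω`, `ω̇ = I − sin θ − (α cos θ − D) ω` [DuEtAl2024, Eq. (1)] at the instance of record «PLLSWING-Du-I04», model-3 `InverterPLL.GenSwing.duI04`; MODEL-VALIDITY MV-6P(GenSwing) + MV-P(I′ = s*): SRF-PLL reduced model, current loops algebraic, PLL filter / limiters / LVRT logic ABSENT). VALIDATED: only the renderings of `s`. No sentence here says a machine, a converter or a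
grid is stable.
-/

namespace Summit.Ventures.GridStability.Bench.PLLSWING

open Literature.Computation.Certificates Literature.Computation.Certificates.SOS
open Literature.Computation.Certificates.SOS.Poly
open Summit.Ventures.GridStability.Lyapunov

noncomputable section

/-- From a passed Bernstein box test to the bound on `V`: if the kernel-computed tensor-Bernstein coefficients of `deg4_A_DuI04_k32_wide_V_poly` on
`[l0, u0] × [l1, u1] × [l2, u2]` are `≤ 41` (`PolyRecast.bernUpper … (bernCoeffs …)`, re-verified representation) and `(σ, κ, ω)` lies in
the box, then `V σ κ ω ≤ 41` (`PolyRecast.eval_le_of_bernCoeffs`). [folklore] -/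
theorem deg4_A_DuI04_k32_wide_V_le_of_bern_B (sigma kappa omega : ℝ) (l0 l1 l2 u0 u1 u2 : ℚ)
    (hdec : PolyRecast.bernUpper deg4_A_DuI04_k32_wide_V_poly [4, 4, 4] (vars [l0, l1, l2]) (vars [u0, u1, u2])
      (PolyRecast.bernCoeffs deg4_A_DuI04_k32_wide_V_poly [4, 4, 4] (vars [l0, l1, l2]) (vars [u0, u1, u2])) (41 : ℚ) = true)
    (hb0 : ((l0 : ℚ) : ℝ) ≤ sigma ∧ sigma ≤ ((u0 : ℚ) : ℝ)) (hb1 : ((l1 : ℚ) : ℝ) ≤ kappa ∧ kappa ≤ ((u1 : ℚ) : ℝ))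
    (hb2 : ((l2 : ℚ) : ℝ) ≤ omega ∧ omega ≤ ((u2 : ℚ) : ℝ)) :
    deg4_A_DuI04_k32_wide_V sigma kappa omega ≤ 41 := by
  have hx : ∀ i, i < ([4, 4, 4] : List ℕ).length → ((vars [l0, l1, l2] i : ℚ) : ℝ) ≤ vars [sigma, kappa, omega] i ∧
      vars [sigma, kappa, omega] i ≤ ((vars [u0, u1, u2] i : ℚ) : ℝ) := by
    intro i hi
    have hi3 : i < 3 := by simpa using hi
    interval_cases i
    · simpa using hb0
    · simpa using hb1
    · simpa using hb2
  have h := PolyRecast.eval_le_of_bernCoeffs (K := ℝ) hdec hx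
  have hc : (((41 : ℚ) : ℚ) : ℝ) = 41 := by norm_num
  exact h.trans_eq hc

/-- Shell 0 of the cover (`(0)² < σ² ≤ (61/200)²`): literal bounds `κ ∈ [0, 1489/31250]`, `|ω| ≤ 991/1000` from `h = 0` and the
gauge, then the two signed boxes 0+ / 0− (box theorems `deg4_A_DuI04_k32_wide_bern_le0p_B` / `deg4_A_DuI04_k32_wide_bern_le0m_B`). [folklore] -/
theorem deg4_A_DuI04_k32_wide_V_le_shell0_B (sigma kappa omega : ℝ) (hh' : sigma ^ 2 + kappa ^ 2 = 2 * kappa)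
    (hball : sigma ^ 2 + kappa ^ 2 + omega ^ 2 ≤ (991 / 1000 : ℝ) ^ 2) (hk1one : kappa ≤ 1) (hk1lo : 0 ≤ kappa)
    (hsq : sigma ^ 2 ≤ (61 / 200 : ℝ) ^ 2) : deg4_A_DuI04_k32_wide_V sigma kappa omega ≤ 41 := by
  have hw2 : 0 ≤ omega ^ 2 := by positivity
  have hkhi : kappa ≤ (1489 / 31250 : ℝ) := RecastShell.kappa_le_of_sq_le hh' hk1one hsq (by norm_num)
  have hklo : (0 : ℝ) ≤ kappa := by simpa using hk1lo
  have hom : -(991 / 1000 : ℝ) ≤ omega ∧ omega ≤ (991 / 1000 : ℝ) :=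
    abs_le_of_sq_le_sq' (by linarith [hh', hball, hk1lo, (by norm_num : ((1 : ℝ)) ^ 2 * ((982081 / 1000000 : ℝ) - 2 * (0 : ℝ)) ≤ (991 / 1000 : ℝ) ^ 2)]) (by norm_num)
  have habs : -(61 / 200 : ℝ) ≤ sigma ∧ sigma ≤ (61 / 200 : ℝ) := abs_le_of_sq_le_sq' hsq (by norm_num)
  rcases le_total 0 sigma with hsg | hsg
  · exact deg4_A_DuI04_k32_wide_V_le_of_bern_B sigma kappa omega _ _ _ _ _ _ deg4_A_DuI04_k32_wide_bern_le0p_B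
      (by push_cast; constructor <;> linarith [hsg, habs.2]) (by push_cast; constructor <;> linarith [hklo, hkhi])
      (by push_cast; constructor <;> linarith [hom.1, hom.2])
  · exact deg4_A_DuI04_k32_wide_V_le_of_bern_B sigma kappa omega _ _ _ _ _ _ deg4_A_DuI04_k32_wide_bern_le0m_B
      (by push_cast; constructor <;> linarith [hsg, habs.1]) (by push_cast; constructor <;> linarith [hklo, hkhi])
      (by push_cast; constructor <;> linarith [hom.1, hom.2])

/-- Shell 1 of the cover (`(61/200)² < σ² ≤ (431/1000)²`): literal bounds `κ ∈ [47647/1000000, 97649/1000000]`, `|ω| ≤ 471/500` from `h = 0` and the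
gauge, then the two signed boxes 1+ / 1− (box theorems `deg4_A_DuI04_k32_wide_bern_le1p_B` / `deg4_A_DuI04_k32_wide_bern_le1m_B`). [folklore] -/
theorem deg4_A_DuI04_k32_wide_V_le_shell1_B (sigma kappa omega : ℝ) (hh' : sigma ^ 2 + kappa ^ 2 = 2 * kappa)
    (hball : sigma ^ 2 + kappa ^ 2 + omega ^ 2 ≤ (991 / 1000 : ℝ) ^ 2) (hk1one : kappa ≤ 1)
    (hlo : (61 / 200 : ℝ) ^ 2 < sigma ^ 2) 
    (hsq : sigma ^ 2 ≤ (431 / 1000 : ℝ) ^ 2) : deg4_A_DuI04_k32_wide_V sigma kappa omega ≤ 41 := by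
  have hw2 : 0 ≤ omega ^ 2 := by positivity
  have hkhi : kappa ≤ (97649 / 1000000 : ℝ) := RecastShell.kappa_le_of_sq_le hh' hk1one hsq (by norm_num)
  have hklo' : (47647 / 1000000 : ℝ) < kappa := RecastShell.lt_kappa_of_lt_sq hh' hk1one hlo (by norm_num) (by norm_num)
  have hklo : (47647 / 1000000 : ℝ) ≤ kappa := hklo'.le
  have hom : -(471 / 500 : ℝ) ≤ omega ∧ omega ≤ (471 / 500 : ℝ) :=
    abs_le_of_sq_le_sq' (by linarith [hh', hball, hklo', (by norm_num : ((1 : ℝ)) ^ 2 * ((982081 / 1000000 : ℝ) - 2 * (47647 / 1000000 : ℝ)) ≤ (471 / 500 : ℝ) ^ 2)]) (by norm_num)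
  have habs : -(431 / 1000 : ℝ) ≤ sigma ∧ sigma ≤ (431 / 1000 : ℝ) := abs_le_of_sq_le_sq' hsq (by norm_num)
  rcases le_total 0 sigma with hsg | hsg
  · have hslo : (61 / 200 : ℝ) < sigma := lt_of_pow_lt_pow_left₀ 2 hsg hlo
    exact deg4_A_DuI04_k32_wide_V_le_of_bern_B sigma kappa omega _ _ _ _ _ _ deg4_A_DuI04_k32_wide_bern_le1p_B
      (by push_cast; constructor <;> linarith [hslo, habs.2]) (by push_cast; constructor <;> linarith [hklo, hkhi])
      (by push_cast; constructor <;> linarith [hom.1, hom.2])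
  · have hshi : (61 / 200 : ℝ) < -sigma := lt_of_pow_lt_pow_left₀ 2 (by linarith) (by rw [neg_sq]; exact hlo)
    exact deg4_A_DuI04_k32_wide_V_le_of_bern_B sigma kappa omega _ _ _ _ _ _ deg4_A_DuI04_k32_wide_bern_le1m_B
      (by push_cast; constructor <;> linarith [hshi, habs.1]) (by push_cast; constructor <;> linarith [hklo, hkhi])
      (by push_cast; constructor <;> linarith [hom.1, hom.2])

/-- Shell 2 of the cover (`(431/1000)² < σ² ≤ (66/125)²`): literal bounds `κ ∈ [6103/62500, 37689/250000]`, `|ω| ≤ 111/125` from `h = 0` and the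
gauge, then the two signed boxes 2+ / 2− (box theorems `deg4_A_DuI04_k32_wide_bern_le2p_B` / `deg4_A_DuI04_k32_wide_bern_le2m_B`). [folklore] -/
theorem deg4_A_DuI04_k32_wide_V_le_shell2_B (sigma kappa omega : ℝ) (hh' : sigma ^ 2 + kappa ^ 2 = 2 * kappa)
    (hball : sigma ^ 2 + kappa ^ 2 + omega ^ 2 ≤ (991 / 1000 : ℝ) ^ 2) (hk1one : kappa ≤ 1)
    (hlo : (431 / 1000 : ℝ) ^ 2 < sigma ^ 2) 
    (hsq : sigma ^ 2 ≤ (66 / 125 : ℝ) ^ 2) : deg4_A_DuI04_k32_wide_V sigma kappa omega ≤ 41 := by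
  have hw2 : 0 ≤ omega ^ 2 := by positivity
  have hkhi : kappa ≤ (37689 / 250000 : ℝ) := RecastShell.kappa_le_of_sq_le hh' hk1one hsq (by norm_num)
  have hklo' : (6103 / 62500 : ℝ) < kappa := RecastShell.lt_kappa_of_lt_sq hh' hk1one hlo (by norm_num) (by norm_num)
  have hklo : (6103 / 62500 : ℝ) ≤ kappa := hklo'.le
  have hom : -(111 / 125 : ℝ) ≤ omega ∧ omega ≤ (111 / 125 : ℝ) :=
    abs_le_of_sq_le_sq' (by linarith [hh', hball, hklo', (by norm_num : ((1 : ℝ)) ^ 2 * ((982081 / 1000000 : ℝ) - 2 * (6103 / 62500 : ℝ)) ≤ (111 / 125 : ℝ) ^ 2)]) (by norm_num)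
  have habs : -(66 / 125 : ℝ) ≤ sigma ∧ sigma ≤ (66 / 125 : ℝ) := abs_le_of_sq_le_sq' hsq (by norm_num)
  rcases le_total 0 sigma with hsg | hsg
  · have hslo : (431 / 1000 : ℝ) < sigma := lt_of_pow_lt_pow_left₀ 2 hsg hlo
    exact deg4_A_DuI04_k32_wide_V_le_of_bern_B sigma kappa omega _ _ _ _ _ _ deg4_A_DuI04_k32_wide_bern_le2p_B
      (by push_cast; constructor <;> linarith [hslo, habs.2]) (by push_cast; constructor <;> linarith [hklo, hkhi])
      (by push_cast; constructor <;> linarith [hom.1, hom.2])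
  · have hshi : (431 / 1000 : ℝ) < -sigma := lt_of_pow_lt_pow_left₀ 2 (by linarith) (by rw [neg_sq]; exact hlo)
    exact deg4_A_DuI04_k32_wide_V_le_of_bern_B sigma kappa omega _ _ _ _ _ _ deg4_A_DuI04_k32_wide_bern_le2m_B
      (by push_cast; constructor <;> linarith [hshi, habs.1]) (by push_cast; constructor <;> linarith [hklo, hkhi])
      (by push_cast; constructor <;> linarith [hom.1, hom.2])

/-- Shell 3 of the cover (`(66/125)² < σ² ≤ (609/1000)²`): literal bounds `κ ∈ [30151/200000, 20683/100000]`, `|ω| ≤ 33/40` from `h = 0` and the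
gauge, then the two signed boxes 3+ / 3− (box theorems `deg4_A_DuI04_k32_wide_bern_le3p_B` / `deg4_A_DuI04_k32_wide_bern_le3m_B`). [folklore] -/
theorem deg4_A_DuI04_k32_wide_V_le_shell3_B (sigma kappa omega : ℝ) (hh' : sigma ^ 2 + kappa ^ 2 = 2 * kappa)
    (hball : sigma ^ 2 + kappa ^ 2 + omega ^ 2 ≤ (991 / 1000 : ℝ) ^ 2) (hk1one : kappa ≤ 1)
    (hlo : (66 / 125 : ℝ) ^ 2 < sigma ^ 2) 
    (hsq : sigma ^ 2 ≤ (609 / 1000 : ℝ) ^ 2) : deg4_A_DuI04_k32_wide_V sigma kappa omega ≤ 41 := by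
  have hw2 : 0 ≤ omega ^ 2 := by positivity
  have hkhi : kappa ≤ (20683 / 100000 : ℝ) := RecastShell.kappa_le_of_sq_le hh' hk1one hsq (by norm_num)
  have hklo' : (30151 / 200000 : ℝ) < kappa := RecastShell.lt_kappa_of_lt_sq hh' hk1one hlo (by norm_num) (by norm_num)
  have hklo : (30151 / 200000 : ℝ) ≤ kappa := hklo'.le
  have hom : -(33 / 40 : ℝ) ≤ omega ∧ omega ≤ (33 / 40 : ℝ) :=
    abs_le_of_sq_le_sq' (by linarith [hh', hball, hklo', (by norm_num : ((1 : ℝ)) ^ 2 * ((982081 / 1000000 : ℝ) - 2 * (30151 / 200000 : ℝ)) ≤ (33 / 40 : ℝ) ^ 2)]) (by norm_num)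
  have habs : -(609 / 1000 : ℝ) ≤ sigma ∧ sigma ≤ (609 / 1000 : ℝ) := abs_le_of_sq_le_sq' hsq (by norm_num)
  rcases le_total 0 sigma with hsg | hsg
  · have hslo : (66 / 125 : ℝ) < sigma := lt_of_pow_lt_pow_left₀ 2 hsg hlo
    exact deg4_A_DuI04_k32_wide_V_le_of_bern_B sigma kappa omega _ _ _ _ _ _ deg4_A_DuI04_k32_wide_bern_le3p_B
      (by push_cast; constructor <;> linarith [hslo, habs.2]) (by push_cast; constructor <;> linarith [hklo, hkhi])
      (by push_cast; constructor <;> linarith [hom.1, hom.2])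
  · have hshi : (66 / 125 : ℝ) < -sigma := lt_of_pow_lt_pow_left₀ 2 (by linarith) (by rw [neg_sq]; exact hlo)
    exact deg4_A_DuI04_k32_wide_V_le_of_bern_B sigma kappa omega _ _ _ _ _ _ deg4_A_DuI04_k32_wide_bern_le3m_B
      (by push_cast; constructor <;> linarith [hshi, habs.1]) (by push_cast; constructor <;> linarith [hklo, hkhi])
      (by push_cast; constructor <;> linarith [hom.1, hom.2])

/-- Shell 4 of the cover (`(609/1000)² < σ² ≤ (681/1000)²`): literal bounds `κ ∈ [206829/1000000, 267717/1000000]`, `|ω| ≤ 377/500` from `h = 0` and the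
gauge, then the two signed boxes 4+ / 4− (box theorems `deg4_A_DuI04_k32_wide_bern_le4p_B` / `deg4_A_DuI04_k32_wide_bern_le4m_B`). [folklore] -/
theorem deg4_A_DuI04_k32_wide_V_le_shell4_B (sigma kappa omega : ℝ) (hh' : sigma ^ 2 + kappa ^ 2 = 2 * kappa)
    (hball : sigma ^ 2 + kappa ^ 2 + omega ^ 2 ≤ (991 / 1000 : ℝ) ^ 2) (hk1one : kappa ≤ 1)
    (hlo : (609 / 1000 : ℝ) ^ 2 < sigma ^ 2) 
    (hsq : sigma ^ 2 ≤ (681 / 1000 : ℝ) ^ 2) : deg4_A_DuI04_k32_wide_V sigma kappa omega ≤ 41 := by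
  have hw2 : 0 ≤ omega ^ 2 := by positivity
  have hkhi : kappa ≤ (267717 / 1000000 : ℝ) := RecastShell.kappa_le_of_sq_le hh' hk1one hsq (by norm_num)
  have hklo' : (206829 / 1000000 : ℝ) < kappa := RecastShell.lt_kappa_of_lt_sq hh' hk1one hlo (by norm_num) (by norm_num)
  have hklo : (206829 / 1000000 : ℝ) ≤ kappa := hklo'.le
  have hom : -(377 / 500 : ℝ) ≤ omega ∧ omega ≤ (377 / 500 : ℝ) :=
    abs_le_of_sq_le_sq' (by linarith [hh', hball, hklo', (by norm_num : ((1 : ℝ)) ^ 2 * ((982081 / 1000000 : ℝ) - 2 * (206829 / 1000000 : ℝ)) ≤ (377 / 500 : ℝ) ^ 2)]) (by norm_num)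
  have habs : -(681 / 1000 : ℝ) ≤ sigma ∧ sigma ≤ (681 / 1000 : ℝ) := abs_le_of_sq_le_sq' hsq (by norm_num)
  rcases le_total 0 sigma with hsg | hsg
  · have hslo : (609 / 1000 : ℝ) < sigma := lt_of_pow_lt_pow_left₀ 2 hsg hlo
    exact deg4_A_DuI04_k32_wide_V_le_of_bern_B sigma kappa omega _ _ _ _ _ _ deg4_A_DuI04_k32_wide_bern_le4p_B
      (by push_cast; constructor <;> linarith [hslo, habs.2]) (by push_cast; constructor <;> linarith [hklo, hkhi])
      (by push_cast; constructor <;> linarith [hom.1, hom.2])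
  · have hshi : (609 / 1000 : ℝ) < -sigma := lt_of_pow_lt_pow_left₀ 2 (by linarith) (by rw [neg_sq]; exact hlo)
    exact deg4_A_DuI04_k32_wide_V_le_of_bern_B sigma kappa omega _ _ _ _ _ _ deg4_A_DuI04_k32_wide_bern_le4m_B
      (by push_cast; constructor <;> linarith [hshi, habs.1]) (by push_cast; constructor <;> linarith [hklo, hkhi])
      (by push_cast; constructor <;> linarith [hom.1, hom.2])

/-- Shell 5 of the cover (`(681/1000)² < σ² ≤ (373/500)²`): literal bounds `κ ∈ [66929/250000, 66811/200000]`, `|ω| ≤ 669/1000` from `h = 0` and the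
gauge, then the two signed boxes 5+ / 5− (box theorems `deg4_A_DuI04_k32_wide_bern_le5p_B` / `deg4_A_DuI04_k32_wide_bern_le5m_B`). [folklore] -/
theorem deg4_A_DuI04_k32_wide_V_le_shell5_B (sigma kappa omega : ℝ) (hh' : sigma ^ 2 + kappa ^ 2 = 2 * kappa)
    (hball : sigma ^ 2 + kappa ^ 2 + omega ^ 2 ≤ (991 / 1000 : ℝ) ^ 2) (hk1one : kappa ≤ 1)
    (hlo : (681 / 1000 : ℝ) ^ 2 < sigma ^ 2) 
    (hsq : sigma ^ 2 ≤ (373 / 500 : ℝ) ^ 2) : deg4_A_DuI04_k32_wide_V sigma kappa omega ≤ 41 := by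
  have hw2 : 0 ≤ omega ^ 2 := by positivity
  have hkhi : kappa ≤ (66811 / 200000 : ℝ) := RecastShell.kappa_le_of_sq_le hh' hk1one hsq (by norm_num)
  have hklo' : (66929 / 250000 : ℝ) < kappa := RecastShell.lt_kappa_of_lt_sq hh' hk1one hlo (by norm_num) (by norm_num)
  have hklo : (66929 / 250000 : ℝ) ≤ kappa := hklo'.le
  have hom : -(669 / 1000 : ℝ) ≤ omega ∧ omega ≤ (669 / 1000 : ℝ) :=
    abs_le_of_sq_le_sq' (by linarith [hh', hball, hklo', (by norm_num : ((1 : ℝ)) ^ 2 * ((982081 / 1000000 : ℝ) - 2 * (66929 / 250000 : ℝ)) ≤ (669 / 1000 : ℝ) ^ 2)]) (by norm_num)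
  have habs : -(373 / 500 : ℝ) ≤ sigma ∧ sigma ≤ (373 / 500 : ℝ) := abs_le_of_sq_le_sq' hsq (by norm_num)
  rcases le_total 0 sigma with hsg | hsg
  · have hslo : (681 / 1000 : ℝ) < sigma := lt_of_pow_lt_pow_left₀ 2 hsg hlo
    exact deg4_A_DuI04_k32_wide_V_le_of_bern_B sigma kappa omega _ _ _ _ _ _ deg4_A_DuI04_k32_wide_bern_le5p_B
      (by push_cast; constructor <;> linarith [hslo, habs.2]) (by push_cast; constructor <;> linarith [hklo, hkhi])
      (by push_cast; constructor <;> linarith [hom.1, hom.2])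
  · have hshi : (681 / 1000 : ℝ) < -sigma := lt_of_pow_lt_pow_left₀ 2 (by linarith) (by rw [neg_sq]; exact hlo)
    exact deg4_A_DuI04_k32_wide_V_le_of_bern_B sigma kappa omega _ _ _ _ _ _ deg4_A_DuI04_k32_wide_bern_le5m_B
      (by push_cast; constructor <;> linarith [hshi, habs.1]) (by push_cast; constructor <;> linarith [hklo, hkhi])
      (by push_cast; constructor <;> linarith [hom.1, hom.2])

/-- Shell 6 of the cover (`(373/500)² < σ² ≤ (403/500)²`): literal bounds `κ ∈ [167027/500000, 81617/200000]`, `|ω| ≤ 561/1000` from `h = 0` and the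
gauge, then the two signed boxes 6+ / 6− (box theorems `deg4_A_DuI04_k32_wide_bern_le6p_B` / `deg4_A_DuI04_k32_wide_bern_le6m_B`). [folklore] -/
theorem deg4_A_DuI04_k32_wide_V_le_shell6_B (sigma kappa omega : ℝ) (hh' : sigma ^ 2 + kappa ^ 2 = 2 * kappa)
    (hball : sigma ^ 2 + kappa ^ 2 + omega ^ 2 ≤ (991 / 1000 : ℝ) ^ 2) (hk1one : kappa ≤ 1)
    (hlo : (373 / 500 : ℝ) ^ 2 < sigma ^ 2) 
    (hsq : sigma ^ 2 ≤ (403 / 500 : ℝ) ^ 2) : deg4_A_DuI04_k32_wide_V sigma kappa omega ≤ 41 := by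
  have hw2 : 0 ≤ omega ^ 2 := by positivity
  have hkhi : kappa ≤ (81617 / 200000 : ℝ) := RecastShell.kappa_le_of_sq_le hh' hk1one hsq (by norm_num)
  have hklo' : (167027 / 500000 : ℝ) < kappa := RecastShell.lt_kappa_of_lt_sq hh' hk1one hlo (by norm_num) (by norm_num)
  have hklo : (167027 / 500000 : ℝ) ≤ kappa := hklo'.le
  have hom : -(561 / 1000 : ℝ) ≤ omega ∧ omega ≤ (561 / 1000 : ℝ) :=
    abs_le_of_sq_le_sq' (by linarith [hh', hball, hklo', (by norm_num : ((1 : ℝ)) ^ 2 * ((982081 / 1000000 : ℝ) - 2 * (167027 / 500000 : ℝ)) ≤ (561 / 1000 : ℝ) ^ 2)]) (by norm_num)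
  have habs : -(403 / 500 : ℝ) ≤ sigma ∧ sigma ≤ (403 / 500 : ℝ) := abs_le_of_sq_le_sq' hsq (by norm_num)
  rcases le_total 0 sigma with hsg | hsg
  · have hslo : (373 / 500 : ℝ) < sigma := lt_of_pow_lt_pow_left₀ 2 hsg hlo
    exact deg4_A_DuI04_k32_wide_V_le_of_bern_B sigma kappa omega _ _ _ _ _ _ deg4_A_DuI04_k32_wide_bern_le6p_B
      (by push_cast; constructor <;> linarith [hslo, habs.2]) (by push_cast; constructor <;> linarith [hklo, hkhi])
      (by push_cast; constructor <;> linarith [hom.1, hom.2])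
  · have hshi : (373 / 500 : ℝ) < -sigma := lt_of_pow_lt_pow_left₀ 2 (by linarith) (by rw [neg_sq]; exact hlo)
    exact deg4_A_DuI04_k32_wide_V_le_of_bern_B sigma kappa omega _ _ _ _ _ _ deg4_A_DuI04_k32_wide_bern_le6m_B
      (by push_cast; constructor <;> linarith [hshi, habs.1]) (by push_cast; constructor <;> linarith [hklo, hkhi])
      (by push_cast; constructor <;> linarith [hom.1, hom.2])

/-- Shell 7 of the cover (`(403/500)² < σ² ≤ (861/1000)²`): literal bounds `κ ∈ [102021/250000, 982081/2000000]`, `|ω| ≤ 51/125` from `h = 0` and the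
gauge, then the two signed boxes 7+ / 7− (box theorems `deg4_A_DuI04_k32_wide_bern_le7p_B` / `deg4_A_DuI04_k32_wide_bern_le7m_B`). [folklore] -/
theorem deg4_A_DuI04_k32_wide_V_le_shell7_B (sigma kappa omega : ℝ) (hh' : sigma ^ 2 + kappa ^ 2 = 2 * kappa)
    (hball : sigma ^ 2 + kappa ^ 2 + omega ^ 2 ≤ (991 / 1000 : ℝ) ^ 2) (hk1one : kappa ≤ 1)
    (hlo : (403 / 500 : ℝ) ^ 2 < sigma ^ 2) 
    (hsq : sigma ^ 2 ≤ (861 / 1000 : ℝ) ^ 2) : deg4_A_DuI04_k32_wide_V sigma kappa omega ≤ 41 := by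
  have hw2 : 0 ≤ omega ^ 2 := by positivity
  have hkhi : kappa ≤ (982081 / 2000000 : ℝ) := by linarith [hh', hball, hw2]
  have hklo' : (102021 / 250000 : ℝ) < kappa := RecastShell.lt_kappa_of_lt_sq hh' hk1one hlo (by norm_num) (by norm_num)
  have hklo : (102021 / 250000 : ℝ) ≤ kappa := hklo'.le
  have hom : -(51 / 125 : ℝ) ≤ omega ∧ omega ≤ (51 / 125 : ℝ) :=
    abs_le_of_sq_le_sq' (by linarith [hh', hball, hklo', (by norm_num : ((1 : ℝ)) ^ 2 * ((982081 / 1000000 : ℝ) - 2 * (102021 / 250000 : ℝ)) ≤ (51 / 125 : ℝ) ^ 2)]) (by norm_num)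
  have habs : -(861 / 1000 : ℝ) ≤ sigma ∧ sigma ≤ (861 / 1000 : ℝ) := abs_le_of_sq_le_sq' hsq (by norm_num)
  rcases le_total 0 sigma with hsg | hsg
  · have hslo : (403 / 500 : ℝ) < sigma := lt_of_pow_lt_pow_left₀ 2 hsg hlo
    exact deg4_A_DuI04_k32_wide_V_le_of_bern_B sigma kappa omega _ _ _ _ _ _ deg4_A_DuI04_k32_wide_bern_le7p_B
      (by push_cast; constructor <;> linarith [hslo, habs.2]) (by push_cast; constructor <;> linarith [hklo, hkhi])
      (by push_cast; constructor <;> linarith [hom.1, hom.2])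
  · have hshi : (403 / 500 : ℝ) < -sigma := lt_of_pow_lt_pow_left₀ 2 (by linarith) (by rw [neg_sq]; exact hlo)
    exact deg4_A_DuI04_k32_wide_V_le_of_bern_B sigma kappa omega _ _ _ _ _ _ deg4_A_DuI04_k32_wide_bern_le7m_B
      (by push_cast; constructor <;> linarith [hshi, habs.1]) (by push_cast; constructor <;> linarith [hklo, hkhi])
      (by push_cast; constructor <;> linarith [hom.1, hom.2])

/-- **«BALL» (recast coordinates, Bernstein enclosure on the manifold-aware signed shell cover, K = 8): the ellipsoid of gauge radius
`991/1000` lies in the certified piece.** For every point of `{h = 0}` with `σ² + κ² + ω² ≤ (991/1000)²`: `V ≤ 41` (shell of `σ²` up to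
`σ_max² = s² − s⁴/4`, then the shell lemmas `…V_le_shell<k>_B`). [folklore] -/
theorem deg4_A_DuI04_k32_wide_V_le_level_of_ball_B (sigma kappa omega : ℝ)
    (hh : deg4_A_DuI04_k32_wide_h sigma kappa omega = 0)
    (hball : sigma ^ 2 + kappa ^ 2 + omega ^ 2 ≤ (991 / 1000 : ℝ) ^ 2) :
    deg4_A_DuI04_k32_wide_V sigma kappa omega ≤ 41 := by
  simp only [deg4_A_DuI04_k32_wide_h, deg4_A_DuI04_k32_wide_h_poly, eval_cons, eval_nil, Monomial.eval_eq, Monomial.evalFrom_cons, Monomial.evalFrom_nil,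
    vars_cons_zero, vars_cons_succ] at hh
  push_cast at hh
  norm_num at hh
  have hh' : sigma ^ 2 + kappa ^ 2 = 2 * kappa := by linarith [hh]
  have hk1lo : 0 ≤ kappa := RecastShell.kappa_nonneg hh'
  have hk1s : kappa ≤ (982081 / 2000000 : ℝ) := by linarith [hh, hball, sq_nonneg sigma, sq_nonneg kappa, sq_nonneg omega]
  have hk1one : kappa ≤ 1 := by linarith [hk1s]
  have hsmax : sigma ^ 2 ≤ (861 / 1000 : ℝ) ^ 2 := by
    have hcut := RecastShell.sq_le_of_kappa_le (m := (982081 / 2000000 : ℝ)) hh' hk1s (by norm_num)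
    have hnum : 2 * (982081 / 2000000 : ℝ) - (982081 / 2000000 : ℝ) ^ 2 ≤ ((861 / 1000 : ℝ)) ^ 2 := by norm_num
    linarith [hcut, hnum]
  rcases le_or_gt (sigma ^ 2) ((61 / 200 : ℝ) ^ 2) with hs1 | hs1
  · exact deg4_A_DuI04_k32_wide_V_le_shell0_B sigma kappa omega hh' hball hk1one hk1lo hs1
  rcases le_or_gt (sigma ^ 2) ((431 / 1000 : ℝ) ^ 2) with hs2 | hs2
  · exact deg4_A_DuI04_k32_wide_V_le_shell1_B sigma kappa omega hh' hball hk1one hs1 hs2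
  rcases le_or_gt (sigma ^ 2) ((66 / 125 : ℝ) ^ 2) with hs3 | hs3
  · exact deg4_A_DuI04_k32_wide_V_le_shell2_B sigma kappa omega hh' hball hk1one hs2 hs3
  rcases le_or_gt (sigma ^ 2) ((609 / 1000 : ℝ) ^ 2) with hs4 | hs4
  · exact deg4_A_DuI04_k32_wide_V_le_shell3_B sigma kappa omega hh' hball hk1one hs3 hs4
  rcases le_or_gt (sigma ^ 2) ((681 / 1000 : ℝ) ^ 2) with hs5 | hs5
  · exact deg4_A_DuI04_k32_wide_V_le_shell4_B sigma kappa omega hh' hball hk1one hs4 hs5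
  rcases le_or_gt (sigma ^ 2) ((373 / 500 : ℝ) ^ 2) with hs6 | hs6
  · exact deg4_A_DuI04_k32_wide_V_le_shell5_B sigma kappa omega hh' hball hk1one hs5 hs6
  rcases le_or_gt (sigma ^ 2) ((403 / 500 : ℝ) ^ 2) with hs7 | hs7
  · exact deg4_A_DuI04_k32_wide_V_le_shell6_B sigma kappa omega hh' hball hk1one hs6 hs7
  exact deg4_A_DuI04_k32_wide_V_le_shell7_B sigma kappa omega hh' hball hk1one hs7 hsmax

end

end Summit.Ventures.GridStability.Bench.PLLSWING
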